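import Summits.QuantumFields.YangMills.Theorems.AllWindowsColdBoxBoxHighLineSmallFieldInsideFPSharp

/-!
# U5-L5 (iii) = T-S5.6′ `SmallFieldInsideFPSharp` BY NAME (planner ym-idea-2 g18's typed task Prop, `Cruxes/BoxWindowHighSU2213/TaskU5L5.lean` 38f2f6600721)
# (LINE-20 U5 ⟨stmt-QuantumFields-24336⟩ `stub_landauThirdOrder`; U5 prep, helper-grade; U5 is UNSTAFFED/OPEN)

Width seat `ym-line-sfw-p2-w4` (prover-ym-line-sfw-p2-w4-g29-0), T-S5.6 lineage (bus 22:06:13Z / 22:22:10Z «L5 (iii) → w4»).  The Theorems copy of the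
task Prop **`SmallFieldInsideFPSharp`** (VERBATIM from the task file; a `Cruxes/` file is not importable from `Theorems/`; the companion defs `edgeMass` /
`ActionSandwichSharp` of the same task file are w2 g32's ✓`…ActionSandwichSharpByName`, not restated here) and the one-liner
★★ **`smallFieldInsideFPSharp : SmallFieldInsideFPSharp`** over w4 g29's def-free ✓`SmallFieldFPSharp.smallFieldInsideFP_sharp`
(✓6a′ `abs_action_sub_boxQuadForm_le_sharp` w2 g32 + ✓h6b′ `ghostDetRatio_sq_le` w3 g40 + ✓`TwoFormGauss.*` / ✓`SmallFieldFPSharp.*` w4 g29 + ✓S3a).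
With L5 (i) ✓`actionSandwichSharp` (w2) and L5 (ii) ✓`GhostFP.sum_abs_ghostM_le` (w3), **lift L5 of `U5-BLOCKERS.md` is complete by name**: the T-S5.6 exponent
`C·r·H⁵ − c·β·s²` becomes `C·r·H⁴·(1 + log H) − c·β·s²` (constraint (d′) `5θ + ε₁ − 1/2 < 2κ₃` instead of (d) `6θ + ε₁ − 1/2 < 2κ₃`).

One definition (the task Prop, verbatim) + one theorem; standard axioms.  HONEST LABEL: U5 prep, helper-grade; U5 ⟨24336⟩ (`stub_landauThirdOrder`, LINE-20) is
UNSTAFFED and OPEN, ⟨24004⟩ OPEN, the seat's own crux ⟨22884⟩ OPEN; no stub is closed by name, no crux, rung or summit is proved; route AllWindowsColdBox is DRAFT;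
**the Yang–Mills mass gap is NOT proved by this file; no summit is proved by a line.**
-/

set_option autoImplicit false

open MeasureTheory Matrix Finset Real

noncomputable section

namespace Summit.QuantumFields.YangMills.Theorems.AllWindowsColdBoxBoxHighLine

/-- **U5-L5 (iii) = T-S5.6′ `SmallFieldInsideFPSharp`** — same binders as ✓`SmallFieldInsideFP` (`H ≥ 1`, `β ≥ 1`, `0 < s`, `4s ≤ r`, `r·H² ≤ c₀`,
`C(1 + log H) ≤ β s²`), sharper exponent: `∫_{chartDomain ∖ smallField s} w_J ≤ C·H⁴·exp(C·r·H⁴·(1 + log H) − c·β·s²) · ∫_{smallField (s/2)} w_J`.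
Route: 6a′ two-form domination `Q_∓ = (1 ∓ C r)Q ∓ C r·N`, normaliser ratio via `Σ_e (hodgeQ H)⁻¹ e e ≤ C·#edges` (S3 ✓`LandauVarianceBounded`
by name: ✓`landauKernelBounds.1`), ghost factor via ✓`ghostTaylor` + ✓`GhostFP.abs_quadVal_ghostM_le`, Haar via ✓`haarTaylor`.
[VERBATIM from `Cruxes/BoxWindowHighSU2213/TaskU5L5.lean`] -/
def SmallFieldInsideFPSharp : Prop :=
  ∃ C c c₀ : ℝ, 0 < c ∧ 0 < c₀ ∧ ∀ H : ℕ, 1 ≤ H → ∀ β r s : ℝ, 1 ≤ β → 0 < s → 4 * s ≤ r → r * (H : ℝ) ^ 2 ≤ c₀ →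
    C * (1 + Real.log H) ≤ β * s ^ 2 →
    ∫ a in chartDomain H \ smallField H s, fpChartWeight β H r a ≤
      C * (H : ℝ) ^ 4 * Real.exp (C * r * (H : ℝ) ^ 4 * (1 + Real.log H) - c * β * s ^ 2) *
        ∫ a in smallField H (s / 2), fpChartWeight β H r a

/-- ★★ **U5-L5 (iii) BY NAME**: `SmallFieldInsideFPSharp` holds (w4 g29's ✓`SmallFieldFPSharp.smallFieldInsideFP_sharp`). -/
theorem smallFieldInsideFPSharp : SmallFieldInsideFPSharp := SmallFieldFPSharp.smallFieldInsideFP_sharp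

end Summit.QuantumFields.YangMills.Theorems.AllWindowsColdBoxBoxHighLine

end
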